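import Literature.Computability.Complexity.PSpaceGapThreshold
import Literature.Computability.Complexity.CHSums
import Literature.Computability.Complexity.FPStringBricks
import HarnessLib

/-!
# Signs of weighted witness sums over `PSPACE`-admissible witnesses are `PSPACE` predicates

Topic `Literature/Computability/Complexity` (space-bounded classes; companion of
`PSpaceGapThreshold.lean`, whose `gapThreshold_mem_PSPACE` puts the comparison
`2^{p(|x|)} < 2·(#₁(u) − #₂(u))` of two `PSPACE` witness counts into `PSPACE`). The certificate
tests of polynomial-space simulations are usually not bare counts but SIGNED WEIGHTED sums
`Σ_Y wt(u, Y)` of small integer weights — e.g. the yes-minus-no balance `Σ_{(b,b')} (4·reA + 3·reB)`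
of the Adleman–DeMarrais–Huang path-pair machine (`ADHPathModel.sum_wtPair`; SIAM J. Comput. 26
(1997), Lemma 6.10), or the pair counts `A_S + (√2/2)·B_S` of Clifford+T query circuits
(`QuantumComplexity/OraclePathSums.lean`) that the `PSPACE^{TQBF}` simulator of Aaronson–Chen's
Lemma 5.3 (CCC 2017, §5.3, "all the computations can be done in PSPACE") must compare — taken over
the witnesses `Y` satisfying an ADMISSIBILITY condition that is itself only a `PSPACE` predicate
(there: "the guessed oracle answers along the path are the true `TQBF` answers").

This file proves that closure property once, in the tree's models (`PSPACE` of `Space.lean`,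
`FP`, `countWitnesses`/`cnt` of `Counting.lean`/`CoinCounting.lean`):

* `signedSum Adm wp wn a u = Σ_{Y ∈ {0,1}^a, ⟨u,Y⟩ ∈ Adm} (|wp ⟨u,Y⟩| − |wn ⟨u,Y⟩|)` — weights are
  read off two string functions in UNARY (positive part `wp`, negative part `wn`);
* `cnt_add_eq_sum_vector` — splitting a count of strings of length `a + k` over the first block
  (the `Complexity`-side twin of `ADHPathModel.cnt_add_eq_sum`); with the tree's `cnt_val_lt`
  (`CHSums.lean`: exactly `θ ≤ 2^k` strings of length `k` have value `< θ`);
* `PSpaceSum.posRel Adm wp r` — the witness relation `{⟨u, Y j⟩ | ⟨u,Y⟩ ∈ Adm ∧ ⟦j⟧ < |wp ⟨u,Y⟩|}`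
  (`|j| = c`; used once with `wp` and once with `wn`), in `PSPACE` (a `P` test intersected with a
  preimage of `Adm`), and `countWitnesses_posRel`: `#posRel^{a+c}(u) = Σ_{Y adm} |wp|` (weights
  `≤ 2^c`);
* **`signedSum_pos_mem_PSPACE`**: for `Adm ∈ PSPACE`, `wp, wn ∈ FP` with values of length `≤ 2^c`,
  a polynomial `r` and a Karp-`PSPACE`-complete `B` (for the unions inside
  `gapThreshold_mem_PSPACE`), `{u | 0 < signedSum Adm wp wn (r(|x|)) u} ∈ PSPACE`, `x = fstP u`
  (apply the gap threshold with `p = 0`: `1 < 2·S ↔ 0 < S` for an integer `S`);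
  `signedSum_neg_mem_PSPACE` (swap the weights) and `signedSum_nonneg/nonpos_mem_PSPACE`
  (complements).

## References

* S. Fenner, L. Fortnow, S. Kurtz, *Gap-definable counting classes*, JCSS 48 (1994), Prop. 4.2
  (thresholds of gap functions), as used in `PSpaceGapThreshold.lean` [FennerFortnowKurtz1994].
* J. Gill, SIAM J. Comput. 6 (1977), Prop. 5.2 (`PP ⊆ PSPACE`: count reusing space) [Gill1977].
* L. M. Adleman, J. DeMarrais, M.-D. A. Huang, SIAM J. Comput. 26 (1997), §6, Lemma 6.10 (proof:
  weighted yes/no counts realised by threshold guesses) [AdlemanDeMarraisHuang1997].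
* S. Aaronson, L. Chen, CCC 2017, §5.3 (p. 23) [AaronsonChen2017] (the consumer in view).
-/

noncomputable section

namespace Literature.Computability.Complexity

open _root_.Computability Polynomial Brick PPSharpP
open scoped Classical

/-! ### Counting lemmas -/

/-- **Splitting a count over the first block**: among strings `Y ++ v` of length `a + k`
(`|Y| = a`), count block by block. (Twin of `ADHPathModel.cnt_add_eq_sum`.) [folklore] -/
theorem cnt_add_eq_sum_vector (a k : ℕ) (E : Set (List Bool)) :
    cnt (a + k) E = ∑ Y : List.Vector Bool a, cnt k {v | Y.toList ++ v ∈ E} := by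
  induction a generalizing E with
  | zero =>
    rw [Fintype.sum_subsingleton _ List.Vector.nil]
    simp
  | succ a ih =>
    rw [show a + 1 + k = (a + k) + 1 by omega, cnt_succ, ih, ih]
    let e : Bool × List.Vector Bool a ≃ List.Vector Bool (a + 1) :=
      { toFun := fun p => p.1 ::ᵥ p.2
        invFun := fun v => (v.head, v.tail)
        left_inv := fun p => by simp
        right_inv := fun v => List.Vector.cons_head_tail v }
    rw [← e.sum_comp, Fintype.sum_prod_type, Fintype.sum_bool]
    simp only [e, Equiv.coe_fn_mk, List.Vector.toList_cons, List.cons_append]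
    rw [add_comm]
    rfl

/-! ### The signed weighted sum -/

/-- **The signed weighted witness sum** `Σ_{Y ∈ {0,1}^a, ⟨u,Y⟩ ∈ Adm} (|wp ⟨u,Y⟩| − |wn ⟨u,Y⟩|)`:
weights read in unary off two string functions, over the admissible witnesses.
[cite: AdlemanDeMarraisHuang1997, §6 Lemma 6.10 (proof: "the number of yes outputs minus the number of no outputs")] -/
def signedSum (Adm : Language Bool) (wp wn : List Bool → List Bool) (a : ℕ) (u : List Bool) : ℤ :=
  ∑ Y : List.Vector Bool a, if boolPair u Y.toList ∈ Adm then
    ((wp (boolPair u Y.toList)).length : ℤ) - ((wn (boolPair u Y.toList)).length : ℤ) else 0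

/-- Swapping the weights negates the sum. [folklore] -/
theorem signedSum_swap (Adm : Language Bool) (wp wn : List Bool → List Bool) (a : ℕ) (u : List Bool) :
    signedSum Adm wn wp a u = -signedSum Adm wp wn a u := by
  unfold signedSum
  rw [← Finset.sum_neg_distrib]
  refine Finset.sum_congr rfl fun Y _ => ?_
  split_ifs <;> ring

namespace PSpaceSum

variable (Adm : Language Bool) (wp : List Bool → List Bool) (r : Polynomial ℕ) (c : ℕ)

/-! ### The witness relation of one weight -/

/-- The argument `⟨u, Y⟩` of the admissibility test and of the weight, read off `z = ⟨u, Y j⟩`: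
`Y = ` the first `r(|fstP u|)` symbols of the witness. [folklore] -/
def admArg : List Bool → List Bool := PSpaceGap.padMap r

/-- The index `j`: the witness after its first `r(|fstP u|)` symbols. [folklore] -/
def idxF : List Bool → List Bool := PSpaceGap.dropPart r

/-- The one-bit test `[⟦j⟧ < |wp ⟨u, Y⟩|]`: `¬ (|wp| ≤ |1^{min(⟦j⟧, |wp|)}|)`. [folklore] -/
def ltT : List Bool → List Bool :=
  notFn (lenLeFn X ∘ fanoutFn (binToUnaryFn ∘ fanoutFn (wp ∘ admArg r) (idxF r)) (wp ∘ admArg r))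

/-- `admArg ∈ FP`. [folklore] -/
theorem admArg_mem_FP : admArg r ∈ FP := PSpaceGap.padMap_mem_FP r

/-- `idxF ∈ FP`. [folklore] -/
theorem idxF_mem_FP : idxF r ∈ FP := PSpaceGap.dropPart_mem_FP r

variable {wp} in
/-- `ltT ∈ FP`. [folklore] -/
theorem ltT_mem_FP (hwp : wp ∈ FP) : ltT wp r ∈ FP :=
  notFn_mem_FP (comp_mem_FP (lenLeFn_mem_FP X) (fanoutFn_mem_FP
    (comp_mem_FP binToUnaryFn_mem_FP (fanoutFn_mem_FP (comp_mem_FP hwp (admArg_mem_FP r)) (idxF_mem_FP r)))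
    (comp_mem_FP hwp (admArg_mem_FP r))))

/-- Value of `admArg` on `⟨u, Y ++ j⟩`, `|Y| = r(|fstP u|)`. [folklore] -/
theorem admArg_boolPair (u Y j : List Bool) (hY : Y.length = r.eval (fstP u).length) :
    admArg r (boolPair u (Y ++ j)) = boolPair u Y := by
  rw [admArg, PSpaceGap.padMap_boolPair, List.take_append_of_le_length hY.ge, List.take_of_length_le hY.le]

/-- Value of `idxF` on `⟨u, Y ++ j⟩`, `|Y| = r(|fstP u|)`. [folklore] -/
theorem idxF_boolPair (u Y j : List Bool) (hY : Y.length = r.eval (fstP u).length) :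
    idxF r (boolPair u (Y ++ j)) = j := by
  rw [idxF, PSpaceGap.dropPart_boolPair, ← hY, List.drop_append_of_le_length le_rfl, List.drop_length,
    List.nil_append]

/-- `ltT` is one bit. [folklore] -/
theorem ltT_eq (z : List Bool) :
    ltT wp r z = [decide (bitsToNat (idxF r z) < (wp (admArg r z)).length)] := by
  have h : (lenLeFn X ∘ fanoutFn (binToUnaryFn ∘ fanoutFn (wp ∘ admArg r) (idxF r)) (wp ∘ admArg r)) z =
      [decide ((wp (admArg r z)).length ≤ min (bitsToNat (idxF r z)) (wp (admArg r z)).length)] := by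
    simp [lenLeFn_boolPair]
  rw [ltT, notFn_apply h]
  by_cases hlt : bitsToNat (idxF r z) < (wp (admArg r z)).length
  · rw [decide_eq_true hlt, decide_eq_false (by omega)]; rfl
  · rw [decide_eq_false hlt, decide_eq_true (by omega)]; rfl

/-- **The witness relation of the weight `wp`**: `⟨u, Y j⟩` with `⟨u, Y⟩ ∈ Adm` and
`⟦j⟧ < |wp ⟨u, Y⟩|`. [cite: AdlemanDeMarraisHuang1997, §6 Lemma 6.10 (proof, steps 4–5: threshold guesses)] -/
def posRel : Language Bool := {z | ltT wp r z = [true]} ⊓ (admArg r ⁻¹' Adm)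

variable {Adm wp} in
/-- `posRel ∈ PSPACE` for `Adm ∈ PSPACE`, `wp ∈ FP`. [cite: AroraBarakCC2009, §4.1 (PSPACE absorbs P)] -/
theorem posRel_mem_PSPACE (hAdm : Adm ∈ PSPACE) (hwp : wp ∈ FP) : posRel Adm wp r ∈ PSPACE :=
  inter_P_mem_PSPACE
    (mem_P_of_mem_FP (ltT_mem_FP r hwp) _ fun z => by
      constructor
      · exact id
      · intro hz
        have h := ltT_eq wp r z
        rcases hb : decide (bitsToNat (idxF r z) < (wp (admArg r z)).length) with _ | _
        · rw [hb] at h; exact h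
        · rw [hb] at h; exact absurd h hz)
    (preimage_mem_PSPACE hAdm (admArg_mem_FP r))

/-- Membership of `⟨u, Y ++ j⟩` in `posRel`. [folklore] -/
theorem boolPair_append_mem_posRel_iff (u Y j : List Bool) (hY : Y.length = r.eval (fstP u).length) :
    boolPair u (Y ++ j) ∈ posRel Adm wp r ↔ boolPair u Y ∈ Adm ∧ bitsToNat j < (wp (boolPair u Y)).length := by
  change (ltT wp r (boolPair u (Y ++ j)) = [true] ∧ admArg r (boolPair u (Y ++ j)) ∈ Adm) ↔ _
  rw [ltT_eq, admArg_boolPair r u Y j hY, idxF_boolPair r u Y j hY]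
  constructor
  · rintro ⟨h1, h2⟩
    exact ⟨h2, of_decide_eq_true (List.cons.inj h1).1⟩
  · rintro ⟨h1, h2⟩
    exact ⟨by rw [decide_eq_true h2], h1⟩

variable {wp} in
/-- **The count of the witness relation is the weighted sum**:
`#posRel^{r(|x|)+c}(u) = Σ_{Y ∈ {0,1}^{r(|x|)}, adm} |wp ⟨u,Y⟩|`, weights `≤ 2^c`.
[cite: AdlemanDeMarraisHuang1997, §6 Lemma 6.10 (proof: "there are abs(a_{P₁,0} a_{P₂,0}) sets of pairs G₁, G₂ for each value of E")] -/
theorem countWitnesses_posRel (hc : ∀ z, (wp z).length ≤ 2 ^ c) (u : List Bool) :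
    (countWitnesses (posRel Adm wp r) (r.eval (fstP u).length + c) u : ℤ) =
      ∑ Y : List.Vector Bool (r.eval (fstP u).length),
        if boolPair u Y.toList ∈ Adm then ((wp (boolPair u Y.toList)).length : ℤ) else 0 := by
  rw [countWitnesses_eq_cnt, cnt_add_eq_sum_vector]
  push_cast
  refine Finset.sum_congr rfl fun Y _ => ?_
  have hY : Y.toList.length = r.eval (fstP u).length := Y.toList_length
  have hset : {v : List Bool | Y.toList ++ v ∈ {y : List Bool | boolPair u y ∈ posRel Adm wp r}} =
      if boolPair u Y.toList ∈ Adm then {j | bitsToNat j < (wp (boolPair u Y.toList)).length} else ∅ := by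
    ext j
    simp only [Set.mem_setOf_eq, boolPair_append_mem_posRel_iff Adm wp r u _ j hY]
    split_ifs with h
    · simp [h]
    · simp [h]
  rw [hset]
  split_ifs with h
  · rw [cnt_val_lt (hc _)]
  · have h0 : cnt c (∅ : Set (List Bool)) = 0 := by
      have h' := cnt_add_cnt_compl c (∅ : Set (List Bool))
      rw [Set.compl_empty, cnt_univ] at h'
      omega
    rw [h0]; simp

end PSpaceSum

/-! ### The closure theorem -/

open PSpaceSum

/-- **Signs of weighted witness sums are `PSPACE` predicates.** For an admissibility relation
`Adm ∈ PSPACE`, weights `wp, wn ∈ FP` of length `≤ 2^c`, a polynomial `r` and a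
Karp-`PSPACE`-complete `B`: `{u | 0 < signedSum Adm wp wn (r(|fstP u|)) u} ∈ PSPACE` — the gap
threshold `1 < 2·(#posRel_wp − #posRel_wn)` of `PSpaceGapThreshold.lean` with `p = 0`.
[cite: FennerFortnowKurtz1994, Proposition 4.2] [cite: Gill1977, Proposition 5.2 (PP ⊆ PSPACE)] -/
theorem signedSum_pos_mem_PSPACE {B : Language Bool} (hB : IsComplete PSPACE B) {Adm : Language Bool}
    (hAdm : Adm ∈ PSPACE) {wp wn : List Bool → List Bool} (hwp : wp ∈ FP) (hwn : wn ∈ FP) (c : ℕ)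
    (hwpc : ∀ z, (wp z).length ≤ 2 ^ c) (hwnc : ∀ z, (wn z).length ≤ 2 ^ c) (r : Polynomial ℕ) :
    {u : List Bool | 0 < signedSum Adm wp wn (r.eval (fstP u).length) u} ∈ PSPACE := by
  have h := gapThreshold_mem_PSPACE hB (posRel_mem_PSPACE r hAdm hwp) (posRel_mem_PSPACE r hAdm hwn)
    (r + Polynomial.C c) (r + Polynomial.C c) 0
  have hset : {u : List Bool | 0 < signedSum Adm wp wn (r.eval (fstP u).length) u} =
      {u : List Bool | (2 : ℤ) ^ (0 : Polynomial ℕ).eval (fstP u).length <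
        2 * ((countWitnesses (posRel Adm wp r) ((r + Polynomial.C c).eval (fstP u).length) u : ℤ) -
          (countWitnesses (posRel Adm wn r) ((r + Polynomial.C c).eval (fstP u).length) u : ℤ))} := by
    ext u
    simp only [Set.mem_setOf_eq, eval_add, eval_C, eval_zero, pow_zero]
    rw [countWitnesses_posRel Adm r c hwpc u, countWitnesses_posRel Adm r c hwnc u, ← Finset.sum_sub_distrib]
    have hS : signedSum Adm wp wn (r.eval (fstP u).length) u =
        ∑ Y : List.Vector Bool (r.eval (fstP u).length),
          ((if boolPair u Y.toList ∈ Adm then ((wp (boolPair u Y.toList)).length : ℤ) else 0) -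
            (if boolPair u Y.toList ∈ Adm then ((wn (boolPair u Y.toList)).length : ℤ) else 0)) := by
      unfold signedSum
      refine Finset.sum_congr rfl fun Y _ => ?_
      split_ifs <;> ring
    rw [← hS]
    omega
  rw [hset]
  exact h

/-- Negativity: `{u | signedSum < 0} ∈ PSPACE` (swap the weights). [cite: FennerFortnowKurtz1994, Proposition 4.2] -/
theorem signedSum_neg_mem_PSPACE {B : Language Bool} (hB : IsComplete PSPACE B) {Adm : Language Bool}
    (hAdm : Adm ∈ PSPACE) {wp wn : List Bool → List Bool} (hwp : wp ∈ FP) (hwn : wn ∈ FP) (c : ℕ)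
    (hwpc : ∀ z, (wp z).length ≤ 2 ^ c) (hwnc : ∀ z, (wn z).length ≤ 2 ^ c) (r : Polynomial ℕ) :
    {u : List Bool | signedSum Adm wp wn (r.eval (fstP u).length) u < 0} ∈ PSPACE := by
  have h := signedSum_pos_mem_PSPACE hB hAdm hwn hwp c hwnc hwpc r
  have hset : {u : List Bool | signedSum Adm wp wn (r.eval (fstP u).length) u < 0} =
      {u : List Bool | 0 < signedSum Adm wn wp (r.eval (fstP u).length) u} := by
    ext u
    simp only [Set.mem_setOf_eq, signedSum_swap Adm wp wn]
    omega
  rw [hset]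
  exact h

/-- Non-negativity: `{u | 0 ≤ signedSum} ∈ PSPACE` (complement of negativity).
[cite: FennerFortnowKurtz1994, Proposition 4.2] -/
theorem signedSum_nonneg_mem_PSPACE {B : Language Bool} (hB : IsComplete PSPACE B) {Adm : Language Bool}
    (hAdm : Adm ∈ PSPACE) {wp wn : List Bool → List Bool} (hwp : wp ∈ FP) (hwn : wn ∈ FP) (c : ℕ)
    (hwpc : ∀ z, (wp z).length ≤ 2 ^ c) (hwnc : ∀ z, (wn z).length ≤ 2 ^ c) (r : Polynomial ℕ) :
    {u : List Bool | 0 ≤ signedSum Adm wp wn (r.eval (fstP u).length) u} ∈ PSPACE := by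
  have h := compl_mem_PSPACE (signedSum_neg_mem_PSPACE hB hAdm hwp hwn c hwpc hwnc r)
  have hset : {u : List Bool | 0 ≤ signedSum Adm wp wn (r.eval (fstP u).length) u} =
      ({u : List Bool | signedSum Adm wp wn (r.eval (fstP u).length) u < 0}ᶜ : Language Bool) := by
    ext u
    exact (not_lt (a := signedSum Adm wp wn (r.eval (fstP u).length) u) (b := 0)).symm
  rw [hset]
  exact h

/-- Non-positivity: `{u | signedSum ≤ 0} ∈ PSPACE`. [cite: FennerFortnowKurtz1994, Proposition 4.2] -/
theorem signedSum_nonpos_mem_PSPACE {B : Language Bool} (hB : IsComplete PSPACE B) {Adm : Language Bool}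
    (hAdm : Adm ∈ PSPACE) {wp wn : List Bool → List Bool} (hwp : wp ∈ FP) (hwn : wn ∈ FP) (c : ℕ)
    (hwpc : ∀ z, (wp z).length ≤ 2 ^ c) (hwnc : ∀ z, (wn z).length ≤ 2 ^ c) (r : Polynomial ℕ) :
    {u : List Bool | signedSum Adm wp wn (r.eval (fstP u).length) u ≤ 0} ∈ PSPACE := by
  have h := compl_mem_PSPACE (signedSum_pos_mem_PSPACE hB hAdm hwp hwn c hwpc hwnc r)
  have hset : {u : List Bool | signedSum Adm wp wn (r.eval (fstP u).length) u ≤ 0} =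
      ({u : List Bool | 0 < signedSum Adm wp wn (r.eval (fstP u).length) u}ᶜ : Language Bool) := by
    ext u
    exact (not_lt (a := (0 : ℤ)) (b := signedSum Adm wp wn (r.eval (fstP u).length) u)).symm
  rw [hset]
  exact h

end Literature.Computability.Complexity

end
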